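import Summits.AtomisticToContinuum.Crystallization.Theorems.ChessboardParticlePlanesPeriodicWindowsBarlowOfLevels
import Mathlib.Analysis.InnerProductSpace.PiL2
import Mathlib.Analysis.Normed.Operator.LinearIsometry
import Literature.MathematicalPhysics.StatisticalMechanics.MuGroundStateConfiguration
import Literature.MathematicalPhysics.StatisticalMechanics.BarlowStacking
import Literature.MathematicalPhysics.StatisticalMechanics.HaggStacking
import Summits.AtomisticToContinuum.Crystallization.Theses.ChessboardParticlePlanes
import Summits.AtomisticToContinuum.Crystallization.Theses.LaminarSixThreeThree
import Summits.AtomisticToContinuum.Crystallization.Theorems.ChessboardParticlePlanesPeriodicWindowsInputGlue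
import Summits.AtomisticToContinuum.Crystallization.Theorems.ChessboardParticlePlanesPeriodicWindowsStubLaminarLimit
import Summits.AtomisticToContinuum.Crystallization.Theorems.ChessboardParticlePlanesLjLaminarWindowsMinDistance
import Summits.AtomisticToContinuum.Crystallization.Theorems.PhononSlackCertificatesPeriodicGivenLayered
import Summits.AtomisticToContinuum.Crystallization.Theorems.ChessboardParticlePlanesPeriodicWindowsStubRecurrentHullPoint
import Summits.AtomisticToContinuum.Crystallization.Theorems.ChessboardParticlePlanesPeriodicWindowsStubLayerData
import Summits.AtomisticToContinuum.Crystallization.Theorems.ChessboardParticlePlanesPeriodicWindowsStubWindowsOfTemplateHullPoint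
import Summits.AtomisticToContinuum.Crystallization.Theorems.ChessboardParticlePlanesPeriodicWindowsStubGapSqueeze
import Summits.AtomisticToContinuum.Crystallization.Theorems.ChessboardParticlePlanesPeriodicWindowsHcTemplateOfHollow
import Summits.AtomisticToContinuum.Crystallization.Theorems.ChessboardParticlePlanesPeriodicWindowsHcHollowClosingOfCerts

/-!
# Crux `PeriodicWindows` (stmt-AtomisticToContinuum-3240) — line `dense-laminar-hull`, lead skeleton rev 10 (c12)

Rev 10 (c12, 22:30Z) = rev 9b with HC `stub_hollowClosing` PROVED: `hc_hollowClosing_of_certs hc_cert_landscape hc_cert_farLayer`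
(landed p174049 over hc_competitor p173754, hc_blockSum p173504, hc_farPair p173137, hc_hk_arith p173526, hc_farOfNotHollow p173778,
hc_badOffsetSyndetic p172815, hc_wideGapSyndetic p172671, hc_compressedHeights p172709, …); the two CERTIFICATE statements are now the
registered stubs `hc_cert_landscape` (E1★) and `hc_cert_farLayer` (E2). Open stubs (7): `stub_denseLaminarHullPoint` (≡ 18044),
`stub_triangularLayers` (≡ 18045, wall), `stub_alignedLayers` (P3a-ii, XL), `stub_scaleWindow` (SW, cert), `hc_cert_landscape` (cert +
local analytic), `hc_cert_farLayer` (cert + crude analytic), `stub_pinning` (PIN, cert). Wave 3 (running): hc_monoGain, hc_symmetrize,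
hc_countSharp, hc_hollowShells (analytic inputs of the two certs' numerics-free parts).


Lead: prover-line-stmt-AtomisticToContinuum-3240-c12-0 (continuation of c11's rev 8, tree `Lines/dense_laminar_hull.lean` @ c11 14:45Z).

Rev 9 = rev 8 with P3b2′ `stub_closingOverTorusSqueezed` RESHAPED and PROVED from four registered stubs:
SW `stub_scaleWindow` (coarse scale window `93/100 ≤ a ≤ 51/50` from absolute bulk optimality — certified numerics, 1-D in `a`),
HC `stub_hollowClosing` (the lead's stub: all consecutive offsets hollow AND all gaps `≤ ĝ(a) = √(1 − a²/3)`, by the density closing with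
the COMBINED competitor offsets ↦ nearest hollow / gaps ↦ `min(gap, ĝ(a))`; numerics-free skeleton + LOCAL analytic hollow coercivity +
two certified families: zeroth-order global landscape grid on `(a, g, θ)` and sup-Hessian of far layers for `H ∈ [3/2, 3]`),
TB `hc_templateOfHollow` (bookkeeping: hollow offsets ⇒ Barlow-type template with a Hägg word), PIN `stub_pinning` (11779-type box
pinning of `a` and the gaps for the explicit Barlow-type family). Why the reshape (c12 analysis, floats `bilayer_scan.py` /
`scale_window.py` in the crux evidence): the single certificate "hollow is the coercive global minimiser of `Φ(a,g,·)` for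
`g ∈ [3/4,1]`" of the c11 roadmap is degenerate at the corner `g → 1` (bridge − hollow = `1e-3`) and FALSE outside a scale window
(`a ≲ 0.8`: atop wins; `a ≳ 1.2`: a ring around atop wins), so the scale window must come first and the competitor must compress the gap
at the same time as it re-registers the offset (then the corner has margin `≈ 0.1` and the only thin region is the local tube around
hollow, which is analytic). Wave 1 (c12, 7 workers): `hc_rot3`, `hc_phiTaylor`, `hc_layerSum_mono`, `hc_layerSum_symm`,
`hc_wideGapSyndetic`, `hc_badOffsetSyndetic`, `hc_templateOfHollow`; lead: `hc_compressedHeights` + HC assembly.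

Registered stubs of rev 9 (7): `stub_denseLaminarHullPoint` (≡ 18044), `stub_triangularLayers` (≡ 18045, wall), `stub_alignedLayers`
(P3a-ii, XL), `stub_scaleWindow` (SW), `stub_hollowClosing` (HC), `hc_templateOfHollow` (TB), `stub_pinning` (PIN).
Rev 9b (c12, 19:45Z): TB LANDED p172673 and imported — 6 open stubs; wave 1 landed all 7 helpers (hc_rot3 p172843, hc_phiTaylor
p172903, hc_layerSum_mono p172601, hc_layerSum_symm p172677, hc_wideGapSyndetic p172671, hc_badOffsetSyndetic p172815, TB) and the
lead's hc_compressedHeights p172709.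

HISTORY (rev 8, c11):

Rev 8 = rev 7 with the three gap-squeeze stubs LANDED and imported (GS1 `stub_wideGapSyndetic` p163884, GS2 `stub_layeredPrisms`
p164098, GS `stub_gapSqueeze` p164993 over the compression competitor p164331/p164584): 4 registered stubs remain —
`stub_denseLaminarHullPoint` (≡ 18044), `stub_triangularLayers` (≡ 18045, wall), `stub_alignedLayers` (P3a-ii, XL),
`stub_closingOverTorusSqueezed` (P3b2′, XL; registry over the offset torus + pinning, gaps already in `[3/4, 1]`).
Infrastructure for P3b2′ LANDED in c11 (registered helpers, `--supports` 3240; not part of the composition): the general-offset LAYER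
CAKE — LC-B `stub_offsetLayerDecay` p165966 (uniform summability/decay `Σ|V| ≤ C/H⁴` of the layer family for arbitrary horizontal offsets,
`a ≥ 7/10`), LC-A `stub_offsetLayerCake` p166078 (site energy of a general layered set layer by layer), the symmetries
`gs_offsetLayer_translate` / `gs_offsetLayer_rotate_hollow` p166233 (rotation by `2π/3` about a hollow site), and LC-C `gs_prismEnergy`
p167004 (prism energy = `K² Σ_m (Φ₀ + Σ' Φ)`). ROADMAP for P3b2′ in `Cruxes/PeriodicWindows/NOTES.md` (c11 addendum).

Rev 7 = rev 6 with
(a) the INPUT side aligned with the split filed on route ChessboardParticlePlanes rev 4 (children 18044/18045/18046, glue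
    18048 closed by p161234): the two board-input stubs `stub_laminarity` (≡ 14293) and `stub_noFoam` (≡ 13453) are replaced
    by ONE stub `stub_denseLaminarHullPoint` ≡ item stmt-18044 `DenseLaminarHullPoint` VERBATIM (⇐ 14293 ∧ 13453 by the landed
    `PeriodicWindowsSplit3.denseLaminarHullPoint_of_board`); `stub_triangularLayers` is item stmt-18045 verbatim as before;
(b) P2 `stub_windowsOfTemplateHullPoint` now IMPORTED from its tree file (p142408) instead of inlined;
(c) P3b2 `stub_closingOverTorus` RESHAPED into
    * `stub_gapSqueeze` (NEW, numerics-free, the lead's stub): every interlayer gap of the aligned layered hull point is `≤ 1`.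
      Mechanism: if `z (m₀+1) - z m₀ = 1 + 2η > 1`, uniform recurrence makes gaps `≥ 1 + η` syndetic in the layer index
      (`stub_wideGapSyndetic`); compress EVERY gap to `min(gap, 1)`: the compressed set `Z'` is again `7/10`-separated, the
      compression is a bijection `Z → Z'` under which every pair distance weakly decreases and is `≥ 1` whenever it changes, so
      by monotonicity of `V_LJ` on `[1, ∞)` every site energy weakly decreases, and decreases by a fixed `c > 0` at every site
      below a gap `≥ 1 + η`; on the prisms `n × K × K` of `Z` and `Z'` (`stub_layeredPrisms`: same cardinality `nK²`, boundary
      functional `O(nK + K²)`) the landed window bounds (U) for `Z` (hull) and (L) for `Z'` (separated) of item 11779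
      (`LayeredHull.wb_upper` / `wb_lower`) leave `c K² (n/(G+1)) ≤ C (nK + K²)` — contradiction for `n = K` large;
    * `stub_wideGapSyndetic` (NEW, worker-sized): recurrence ⇒ wide gaps recur with bounded index gaps;
    * `stub_layeredPrisms` (NEW, worker-sized): prisms of a GENERAL layered set (arbitrary bounded horizontal offsets, arbitrary
      heights with gaps `≥ 3/4`): `W ⊆ S`, `#W = nK²`, `Σ_{p∈W} (1 + dist(p, S ∖ W))⁻³ ≤ C (nK + K²)` (the offset-torus analogue of
      the boundary part of `LayeredHull.cake_prisms`);
    * `stub_closingOverTorusSqueezed` (the XL remainder): P3b2 under the extra hypothesis that all gaps are `≤ 1` — registry over the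
      offset torus + pinning of gaps / scale into the box, certified numerics on gaps `∈ [3/4, 1]` only;
    and `stub_closingOverTorus` (rev 4–6 stub) PROVED from `stub_gapSqueeze` and `stub_closingOverTorusSqueezed` (two lines).

Registered stubs of rev 7 (7): `stub_denseLaminarHullPoint` (≡ 18044, W1 + cohesion), `stub_triangularLayers` (≡ 18045, the W2
wall), `stub_alignedLayers` (P3a-ii, XL), `stub_wideGapSyndetic`, `stub_layeredPrisms`, `stub_gapSqueeze`,
`stub_closingOverTorusSqueezed` (XL) — of which GS1/GS2/GS landed within c11 (rev 8: 4 open). Everything else — P1, P2, P3b1 (landed), P3a, P3b, P3b2, P3, old stub 3,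
`PeriodicWindows_of` — carries no `sorry` of its own.

History. Rev 6 (c10) = rev 5 with P3a split into P3a-i `stub_triangularLayers` (wall) + P3a-ii `stub_alignedLayers`; rev 5 (c9) =
rev 4 with P3b1 landed; rev 4 = rev 3 with P3b split into P3b1 `stub_layerData` (bookkeeping) and P3b2 `stub_closingOverTorus`
(density closing over the offset torus + pinning); rev 3 = rev 2 with P3 split into P3a/P3b; rev 2 = rev 1 with P1/P2 landed;
rev 1 (c9) = the crux-strategist's alternative skeleton (s1) with its load-bearing stub 3 `stub_layeredOfDenseLaminarHullPoint`
reshaped into P1 (re-rooting + abstract minimality, `CleanHull.stub_minimalRecurrent`), P3 (rigidity of the recurrent hull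
point = rigid image of a layered template `S(a, s, z)`), P2 (template hull point ⇒ layered windows along `x`) and proved from them.
-/


noncomputable section

namespace Summit.AtomisticToContinuum.Crystallization.Theorems.PeriodicWindowsDenseLaminarHull

open Literature.MathematicalPhysics.StatisticalMechanics Filter Metric
open Summit.AtomisticToContinuum.Crystallization.Theses.ChessboardParticlePlanes (PeriodicWindows)

/-! ## Input stub — a dense laminar separated rotated-hull point (BOARD INPUT = item stmt-AtomisticToContinuum-18044
`ChessboardParticlePlanes.DenseLaminarHullPoint`, verbatim; ⇐ items 14293 `LjLaminarity` ∧ 13453 `NoFoam` by the landed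
`PeriodicWindowsSplit3.denseLaminarHullPoint_of_board`, p161234) -/

/-- INPUT STUB (board input ≡ item stmt-18044 `DenseLaminarHullPoint`, verbatim — wall W1 + cohesion in hull form): there is
`ρ₀ > 0` such that every sequence of Lennard-Jones ground states has, in its rotated hull, a `ρ₀`-relatively dense, exactly
laminar (horizontal levels pairwise `≥ 3/4` apart), `7/10`-separated point. Implied by items 14293 ∧ 13453 through the landed
G0 `laminarWindowsGeom_of`, `LjLaminarWindowsSketch.stub_separationDensity` and S1 `stub_laminarLimit` (see
`PeriodicWindowsSplit3.denseLaminarHullPoint_of`);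
it has its own item and is NOT worked in this line. -/
theorem stub_denseLaminarHullPoint : ∃ ρ₀ : ℝ, 0 < ρ₀ ∧
    ∀ x : (N : ℕ) → (Fin N → EuclideanSpace ℝ (Fin 3)), (∀ N, IsGroundState lennardJones (x N)) →
    ∃ X : Set (EuclideanSpace ℝ (Fin 3)),
      (∃ (σ : ℕ → ℕ) (τ : ℕ → EuclideanSpace ℝ (Fin 3))
          (A : ℕ → (EuclideanSpace ℝ (Fin 3) ≃ₗᵢ[ℝ] EuclideanSpace ℝ (Fin 3))),
        StrictMono σ ∧ ∀ R ε : ℝ, 0 < ε → ∀ᶠ j in Filter.atTop,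
          BallMatch ε R 0 (Set.range fun i => A j (x (σ j) i) + τ j) X) ∧
      (∀ c : EuclideanSpace ℝ (Fin 3), ∃ p ∈ X, dist p c ≤ ρ₀) ∧
      (∀ p ∈ X, ∀ q ∈ X, p 2 ≠ q 2 → (3 : ℝ) / 4 ≤ |p 2 - q 2|) ∧
      (∀ p ∈ X, ∀ q ∈ X, p ≠ q → (7 : ℝ) / 10 ≤ dist p q) := by
  sorry

/-! ## Stub P1 `stub_recurrentHullPoint` — LANDED p141859 (imported: …StubRecurrentHullPoint.lean) -/


/-! ## Stub P3a-i — THE WALL: every layer is a triangular lattice (planar Lennard-Jones order at `ε = 0`) -/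

/-- STUB P3a-i (crux-sized — the irreducible open content of the line, registered so that it can be promoted by
name): let `x` be a sequence of Lennard-Jones ground states and `Z` a rooted, rooted-uniformly recurrent, `ρ₀`-dense,
exactly laminar (horizontal layers, distinct heights `≥ 3/4` apart), `7/10`-separated point of its rotated hull. Then
EVERY layer `{q ∈ Z | q 2 = p 2}` is a translate `p + ℤu + ℤv` of some horizontal triangular lattice (`‖u‖ = ‖v‖ = a`,
angle `π/3`; `a`, `u`, `v` may depend on the layer). Planar Lennard-Jones crystallization with the smeared field of the
other layers; behind `Literature.Barriers.AtomisticToContinuum.LocalizedPotentialsExcludeLennardJones` (Theil 2006 /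
E–Li 2009 need narrow wells; De Luca–Friesecke 2017: open even in `d = 2`). The tree offers bulk optimality of `Z` from
ABOVE only (`rotHull_energetics`, `LayeredHull.stub_windowBounds`); the missing piece is a coercive LOWER bound for the
layer energy over arbitrary `7/10`-separated planar sets. -/
theorem stub_triangularLayers : ∀ ρ₀ : ℝ, 0 < ρ₀ →
    ∀ x : (N : ℕ) → (Fin N → EuclideanSpace ℝ (Fin 3)), (∀ N, IsGroundState lennardJones (x N)) →
    ∀ Z : Set (EuclideanSpace ℝ (Fin 3)), (0 : EuclideanSpace ℝ (Fin 3)) ∈ Z →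
    (∃ (σ : ℕ → ℕ) (τ : ℕ → EuclideanSpace ℝ (Fin 3))
        (A : ℕ → (EuclideanSpace ℝ (Fin 3) ≃ₗᵢ[ℝ] EuclideanSpace ℝ (Fin 3))),
      StrictMono σ ∧ ∀ R ε : ℝ, 0 < ε → ∀ᶠ j in Filter.atTop,
        BallMatch ε R 0 (Set.range fun i => A j (x (σ j) i) + τ j) Z) →
    (∀ c : EuclideanSpace ℝ (Fin 3), ∃ p ∈ Z, dist p c ≤ ρ₀) →
    (∀ p ∈ Z, ∀ q ∈ Z, p 2 ≠ q 2 → (3 : ℝ) / 4 ≤ |p 2 - q 2|) →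
    (∀ p ∈ Z, ∀ q ∈ Z, p ≠ q → (7 : ℝ) / 10 ≤ dist p q) →
    (∀ R ε : ℝ, 0 < ε → ∃ G : ℝ, ∀ w ∈ Z, ∃ g ∈ Z, dist g w ≤ G ∧
      BallMatch ε R 0 ((fun p => p - g) '' Z) Z) →
    ∀ p ∈ Z, ∃ a : ℝ, 0 < a ∧ ∃ u v : EuclideanSpace ℝ (Fin 3), u 2 = 0 ∧ v 2 = 0 ∧ ‖u‖ = a ∧ ‖v‖ = a ∧
      inner ℝ u v = a ^ 2 / 2 ∧
      {q | q ∈ Z ∧ q 2 = p 2} = {q | ∃ i j : ℤ, q = p + (i : ℝ) • u + (j : ℝ) • v} := by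
  sorry

/-! ## Stub P3a-ii — alignment: per-layer triangular lattices are translates of ONE lattice (11779-type, XL) -/

/-- STUB P3a-ii (crux-sized engineering, registered so that it can be promoted by name; NOT behind the localisation
barrier): under the hypotheses of P3a-i, if every layer of `Z` is a translate of some horizontal triangular lattice,
then all layers are translates of ONE horizontal triangular lattice `ℤu + ℤv` (common spacing and orientation: no
twist, no spacing mismatch between layers). Expected mechanism: an adjacent pair of layers with a relative twist or a
spacing mismatch has lateral phases that equidistribute on the offset torus (irrational case) or on a shifted finite
subgroup of order `≥ 4` (coincidence case), so its registry energy per site is an AVERAGE of the bilayer registry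
landscape `Φ₁(g, ·)` over that set, exceeding `min Φ₁(g, ·)` by a constant `c(g) > 0` (certified numerics for gaps
`g ∈ [3/4, 1]`; larger gaps are squeezed out first — GAP SQUEEZE: lowering the upper block by `g - 1` keeps every
straddling pair of layers at `|H| ≥ 1`, where `Φ(H, θ) = Σ_ℓ V(√(H² + |ℓ + θ|²))` is increasing in `|H|` for every `θ`
because `V_LJ` is increasing on `[1, ∞)` — no numerics), while a spacing RATIO far from `1` is priced instead by the
per-particle cohesion deficit of the sparser layer against `2 e(hcp)`; the defective pair lies in some `B(0, R)` and
therefore recurs within `G(R, ε)` of every point of `Z` (uniform recurrence), so on prisms `n × K × K`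
the excess is linear in `n K²`, while the landed window bounds (U)/(L) of `LayeredHull.stub_windowBounds` (item 11779,
available for rotated-hull points through `rotHull_energetics`) against the re-aligned prism of EQUAL cardinality
differ by `O(nK + K²)`. Same certified registry numerics as P3b2. -/
theorem stub_alignedLayers : ∀ ρ₀ : ℝ, 0 < ρ₀ →
    ∀ x : (N : ℕ) → (Fin N → EuclideanSpace ℝ (Fin 3)), (∀ N, IsGroundState lennardJones (x N)) →
    ∀ Z : Set (EuclideanSpace ℝ (Fin 3)), (0 : EuclideanSpace ℝ (Fin 3)) ∈ Z →
    (∃ (σ : ℕ → ℕ) (τ : ℕ → EuclideanSpace ℝ (Fin 3))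
        (A : ℕ → (EuclideanSpace ℝ (Fin 3) ≃ₗᵢ[ℝ] EuclideanSpace ℝ (Fin 3))),
      StrictMono σ ∧ ∀ R ε : ℝ, 0 < ε → ∀ᶠ j in Filter.atTop,
        BallMatch ε R 0 (Set.range fun i => A j (x (σ j) i) + τ j) Z) →
    (∀ c : EuclideanSpace ℝ (Fin 3), ∃ p ∈ Z, dist p c ≤ ρ₀) →
    (∀ p ∈ Z, ∀ q ∈ Z, p 2 ≠ q 2 → (3 : ℝ) / 4 ≤ |p 2 - q 2|) →
    (∀ p ∈ Z, ∀ q ∈ Z, p ≠ q → (7 : ℝ) / 10 ≤ dist p q) →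
    (∀ R ε : ℝ, 0 < ε → ∃ G : ℝ, ∀ w ∈ Z, ∃ g ∈ Z, dist g w ≤ G ∧
      BallMatch ε R 0 ((fun p => p - g) '' Z) Z) →
    (∀ p ∈ Z, ∃ a : ℝ, 0 < a ∧ ∃ u v : EuclideanSpace ℝ (Fin 3), u 2 = 0 ∧ v 2 = 0 ∧ ‖u‖ = a ∧ ‖v‖ = a ∧
      inner ℝ u v = a ^ 2 / 2 ∧
      {q | q ∈ Z ∧ q 2 = p 2} = {q | ∃ i j : ℤ, q = p + (i : ℝ) • u + (j : ℝ) • v}) →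
    ∃ a : ℝ, 0 < a ∧ ∃ u v : EuclideanSpace ℝ (Fin 3), u 2 = 0 ∧ v 2 = 0 ∧ ‖u‖ = a ∧ ‖v‖ = a ∧
      inner ℝ u v = a ^ 2 / 2 ∧
      ∀ p ∈ Z, {q | q ∈ Z ∧ q 2 = p 2} = {q | ∃ i j : ℤ, q = p + (i : ℝ) • u + (j : ℝ) • v} := by
  sorry

/-! ## P3a — aligned triangular layers, now PROVED from P3a-i and P3a-ii -/

/-- P3a (rev 3–5 stub, now a theorem modulo P3a-i/P3a-ii): let `x` be a sequence of Lennard-Jones ground states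
and `Z` a rooted, rooted-uniformly recurrent, `ρ₀`-dense, exactly laminar, `7/10`-separated point of its rotated hull.
Then ALL layers of `Z` are translates of ONE horizontal triangular lattice `ℤu + ℤv` (`‖u‖ = ‖v‖ = a`, angle `π/3`):
in-layer order (P3a-i, the wall) plus a common spacing and orientation across layers (P3a-ii). -/
theorem stub_alignedTriangularLayers : ∀ ρ₀ : ℝ, 0 < ρ₀ →
    ∀ x : (N : ℕ) → (Fin N → EuclideanSpace ℝ (Fin 3)), (∀ N, IsGroundState lennardJones (x N)) →
    ∀ Z : Set (EuclideanSpace ℝ (Fin 3)), (0 : EuclideanSpace ℝ (Fin 3)) ∈ Z →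
    (∃ (σ : ℕ → ℕ) (τ : ℕ → EuclideanSpace ℝ (Fin 3))
        (A : ℕ → (EuclideanSpace ℝ (Fin 3) ≃ₗᵢ[ℝ] EuclideanSpace ℝ (Fin 3))),
      StrictMono σ ∧ ∀ R ε : ℝ, 0 < ε → ∀ᶠ j in Filter.atTop,
        BallMatch ε R 0 (Set.range fun i => A j (x (σ j) i) + τ j) Z) →
    (∀ c : EuclideanSpace ℝ (Fin 3), ∃ p ∈ Z, dist p c ≤ ρ₀) →
    (∀ p ∈ Z, ∀ q ∈ Z, p 2 ≠ q 2 → (3 : ℝ) / 4 ≤ |p 2 - q 2|) →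
    (∀ p ∈ Z, ∀ q ∈ Z, p ≠ q → (7 : ℝ) / 10 ≤ dist p q) →
    (∀ R ε : ℝ, 0 < ε → ∃ G : ℝ, ∀ w ∈ Z, ∃ g ∈ Z, dist g w ≤ G ∧
      BallMatch ε R 0 ((fun p => p - g) '' Z) Z) →
    ∃ a : ℝ, 0 < a ∧ ∃ u v : EuclideanSpace ℝ (Fin 3), u 2 = 0 ∧ v 2 = 0 ∧ ‖u‖ = a ∧ ‖v‖ = a ∧
      inner ℝ u v = a ^ 2 / 2 ∧
      ∀ p ∈ Z, {q | q ∈ Z ∧ q 2 = p 2} = {q | ∃ i j : ℤ, q = p + (i : ℝ) • u + (j : ℝ) • v} := by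
  intro ρ₀ hρ₀ x hx Z h0 hhull hdense hlam hsep hrec
  exact stub_alignedLayers ρ₀ hρ₀ x hx Z h0 hhull hdense hlam hsep hrec
    (stub_triangularLayers ρ₀ hρ₀ x hx Z h0 hhull hdense hlam hsep hrec)

/-! ## Stub P3b1 `stub_layerData` — LANDED p143333 (imported: …StubLayerData.lean) -/

/-! ## Stubs GS1 `stub_wideGapSyndetic`, GS2 `stub_layeredPrisms`, GS `stub_gapSqueeze` — LANDED (c11: p163884, p164098, p164993;
imported: …StubWideGapSyndetic.lean, …StubLayeredPrisms.lean, …StubGapSqueeze.lean, with the compression competitor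
…GapSqueezeCompetitor1/2.lean p164331 / p164584). Every interlayer gap of the aligned layered hull point is `≤ 1`. -/

/-! ## Stub P3b2′ — RESHAPED (rev 9, c12) into SW (scale window) ∘ HC (hollow closing) ∘ TB (template bookkeeping) ∘ PIN (box pinning) -/

/-- STUB SW `stub_scaleWindow` (c12; certified-numerics stub, 1-D in `a` plus torus minima): under the hypotheses of P3b2′ the layer
spacing lies in the COARSE window `93/100 ≤ a ≤ 51/50`. Mechanism: bulk optimality from ABOVE — the prism energies of the hull point `Z` are
`≤ 2 E(nK²) + O(nK + K²)` ((U) `LayeredHull.wb_upper` via `gs_hull_translate`, prisms `stub_layeredPrisms`, energies layer by layer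
`gs_prismEnergy`) and `E(N)/N → e_* ≤ e(hcp) ≤ -0.71749` (`stub_hcpTrialEnergy`, `CrysEnergyLimit`), while EVERY general layered set of
spacing `a` with gaps `≥ 3/4` has mean site energy `≥ LB(a) := Φ₀(a) + 2 min_{g ∈ [3/4,1], θ} Φ(a,g,θ) + 2 min_θ Φ(a,3/2,θ) +
2 min_θ Φ(a,9/4,θ) + 2 Σ_{k ≥ 4} min_θ Φ(a,3k/4,θ)` (layer sums increasing in `|H|` beyond distance `1`, `hc_layerSum_mono`); floats:
`LB(a) − 2e(hcp) = +0.015 (a = 0.93), −0.013 (0.94), −0.039 (0.97), −0.011 (1.00), +0.044 (1.03), +0.19 (0.90 / 1.10)` — certified interval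
versions of the four lattice-sum minima (kernel `decide` technology of `…EnvelopeEval`) are the content. Not behind any barrier. -/
theorem stub_scaleWindow : ∀ ρ₀ : ℝ, 0 < ρ₀ →
    ∀ x : (N : ℕ) → (Fin N → EuclideanSpace ℝ (Fin 3)), (∀ N, IsGroundState lennardJones (x N)) →
    ∀ Z : Set (EuclideanSpace ℝ (Fin 3)), (0 : EuclideanSpace ℝ (Fin 3)) ∈ Z →
    (∃ (σ : ℕ → ℕ) (τ : ℕ → EuclideanSpace ℝ (Fin 3))
        (A : ℕ → (EuclideanSpace ℝ (Fin 3) ≃ₗᵢ[ℝ] EuclideanSpace ℝ (Fin 3))),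
      StrictMono σ ∧ ∀ R ε : ℝ, 0 < ε → ∀ᶠ j in Filter.atTop,
        BallMatch ε R 0 (Set.range fun i => A j (x (σ j) i) + τ j) Z) →
    (∀ c : EuclideanSpace ℝ (Fin 3), ∃ p ∈ Z, dist p c ≤ ρ₀) →
    (∀ p ∈ Z, ∀ q ∈ Z, p 2 ≠ q 2 → (3 : ℝ) / 4 ≤ |p 2 - q 2|) →
    (∀ p ∈ Z, ∀ q ∈ Z, p ≠ q → (7 : ℝ) / 10 ≤ dist p q) →
    (∀ R ε : ℝ, 0 < ε → ∃ G : ℝ, ∀ w ∈ Z, ∃ g ∈ Z, dist g w ≤ G ∧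
      BallMatch ε R 0 ((fun p => p - g) '' Z) Z) →
    ∀ a : ℝ, 0 < a →
    ∀ (B : EuclideanSpace ℝ (Fin 3) ≃ₗᵢ[ℝ] EuclideanSpace ℝ (Fin 3)) (δ : ℤ → EuclideanSpace ℝ (Fin 3)) (z : ℤ → ℝ),
    (∀ p : EuclideanSpace ℝ (Fin 3), (B p) 2 = p 2) → (∀ m : ℤ, (δ m) 2 = 0) → δ 0 = 0 → z 0 = 0 → StrictMono z →
    (∀ m : ℤ, (3 : ℝ) / 4 ≤ z (m + 1) - z m) → (∀ m : ℤ, z (m + 1) - z m ≤ 2 * ρ₀) →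
    Z = (fun p => B p) '' {p | ∃ m i j : ℤ, p = ((i : ℝ) • triangularVec₁ a) +
      ((j : ℝ) • triangularVec₂ a) + δ m + (z m • layerNormal 1)} →
    (∀ m : ℤ, z (m + 1) - z m ≤ 1) →
    93 / 100 ≤ a ∧ a ≤ 51 / 50 := by
  sorry

/-- CERTIFICATE STUB E1★ `hc_cert_landscape` (c12; XL certified numerics + the LOCAL analytic hollow coercivity): for
`a ∈ [93/100, 51/50]`, `g ∈ [3/4, 1]` and every horizontal offset `θ` there is a hollow vector `w ∈ {±b} + ℤv₁ + ℤv₂` with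
`‖θ − w‖ ≤ a` and `Φ(a,g,θ) − Φ(a, min(g, ĝ(a)), w) ≥ (1/5)‖θ − w‖² + (g − ĝ(a))₊²`, `ĝ(a) = √(1 − a²/3)`. Validated by floats
(`Cruxes/PeriodicWindows` evidence `check_E1.py`: the minimum of the slack is `0`, attained only at `θ = w`, `g ≤ ĝ`; min ratio `0.277 ≥ 1/5`
off `d ≤ 0.03`; binding corner `g = 1`, atop, `a = 1.02`). Content: (i) LOCAL (`‖θ − w‖ ≤ 1/20`, `g ≤ ĝ + 1/20`): analytic, by the 3-fold
symmetrisation (`hc_rot3`, `hc_rot3_cubic`), the order-3 Taylor bound `hc_phiTaylor3` termwise, explicit near-shell coefficients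
(`κ₂(ĝ) ≈ 1.15`, net `≥ 0.3` at `r₀ = 1/20`) and crude far-shell sums; the gain `Φ(a,g,w) − Φ(a,ĝ,w) ≥ (g − ĝ)²` for `g ≥ ĝ` is
elementary (three nearest bonds, `V(ρ) − V(1) = (ρ⁻⁶ − 1)²/12`); (ii) GLOBAL: zeroth-order kernel grid (`decide` technology of
`…EnvelopeEval`) on `(a, g, θ)` off the local tube, margins `≥ 5e-4`. -/
theorem hc_cert_landscape : ∀ a : ℝ, 93 / 100 ≤ a → a ≤ 51 / 50 → ∀ g : ℝ, (3 : ℝ) / 4 ≤ g → g ≤ 1 →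
    ∀ θ : EuclideanSpace ℝ (Fin 3), θ 2 = 0 →
    ∃ w : EuclideanSpace ℝ (Fin 3), (∃ s i j : ℤ, (s = 1 ∨ s = -1) ∧
      w = (s : ℝ) • barlowOffset a + (i : ℝ) • triangularVec₁ a + (j : ℝ) • triangularVec₂ a) ∧ ‖θ - w‖ ≤ a ∧
      (1 / 5 : ℝ) * ‖θ - w‖ ^ 2 + 1 * (max (g - Real.sqrt (1 - a ^ 2 / 3)) 0) ^ 2 ≤
        (∑' ij : ℤ × ℤ, lennardJones ‖((ij.1 : ℝ)) • triangularVec₁ a + ((ij.2 : ℝ)) • triangularVec₂ a + θ +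
            g • layerNormal 1‖) -
        (∑' ij : ℤ × ℤ, lennardJones ‖((ij.1 : ℝ)) • triangularVec₁ a + ((ij.2 : ℝ)) • triangularVec₂ a + w +
            (min g (Real.sqrt (1 - a ^ 2 / 3))) • layerNormal 1‖) := by
  sorry

/-- CERTIFICATE STUB E2 `hc_cert_farLayer` (c12; certified numerics for `k = 2..10`, crude analytic beyond): the sup-quadratic constant of
the layer interaction at layer distance `k` (`|H| ≥ 3k/4`) about the 3-fold symmetric points `w ∈ {0, ±b}`:
`|Φ(a,H,w+ξ) − Φ(a,H,w)| ≤ h_k ‖ξ‖²` for horizontal `ξ`, `‖ξ‖ ≤ 2a`, with the table `h_2 = 1/250`, `h_k = 1/12500 (3 ≤ k ≤ 10)`,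
`h_k = 24/((3/4)k)^6 (k ≥ 11)` (floats: true sup `1.8e-3` at `H = 3/2`, `a = 1.02`; Poisson decay `e^{−7.3 H/a}` beyond). The table's
arithmetic `Σ 2k²h_k ≤ 1/5`, `Σ k³h_k ≤ 2` is the landed `hc_hk_arith`. Content: sup-Hessian / direct quadratic kernel grids on
`(a, H, θ)` for `H ∈ [3/2, 33/4]` and the crude symmetrised first-order Taylor bound (`hc_rot3`, `hc_phiTaylor`, sharp lattice counting)
for `H ≥ 33/4`. -/
theorem hc_cert_farLayer : ∀ a : ℝ, 93 / 100 ≤ a → a ≤ 51 / 50 → ∀ (k : ℕ) (H : ℝ), 2 ≤ k → (3 : ℝ) / 4 * k ≤ |H| →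
    ∀ (w ξ : EuclideanSpace ℝ (Fin 3)), (w = 0 ∨ w = barlowOffset a ∨ w = -barlowOffset a) → ξ 2 = 0 → ‖ξ‖ ≤ 2 * a →
    |(∑' ij : ℤ × ℤ, lennardJones ‖((ij.1 : ℝ)) • triangularVec₁ a + ((ij.2 : ℝ)) • triangularVec₂ a + (w + ξ) +
          H • layerNormal 1‖) -
        (∑' ij : ℤ × ℤ, lennardJones ‖((ij.1 : ℝ)) • triangularVec₁ a + ((ij.2 : ℝ)) • triangularVec₂ a + w +
          H • layerNormal 1‖)| ≤
      (if k ≤ 2 then (1 : ℝ) / 250 else if k ≤ 10 then 1 / 12500 else 24 / ((3 : ℝ) / 4 * k) ^ 6) * ‖ξ‖ ^ 2 := by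
  sorry

/-- HC `stub_hollowClosing` (c12; PROVED from the two certificate stubs by the landed `hc_hollowClosing_of_certs`, p174049 — registry over the offset torus + the second gap squeeze, by the COMBINED competitor):
under the hypotheses of P3b2′ and the scale window, EVERY consecutive offset `δ (m+1) - δ m` is a hollow vector `± barlowOffset a` up to the
layer lattice `ℤ v₁ + ℤ v₂`, and EVERY gap is `≤ ĝ(a) := √(1 - a²/3)` (the gap at which the three hollow bonds have length exactly `1`).
Mechanism (density closing as in `stub_gapSqueeze`, with the competitor `Z'`: offsets `θ_m ↦ w_m` = nearest hollow vector, heights compressed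
to increments `min(gap, ĝ(a))` — `hc_compressedHeights`): adjacent pairs gain `Φ(a,g_m,θ_m) − Φ(a,min(g_m,ĝ),w_m) ≥ κ ‖θ_m − w_m‖² + γ·1[bad]`
(E1★ = LOCAL hollow coercivity, analytic by the 3-fold symmetrisation `hc_rot3` + termwise second-order Taylor `hc_phiTaylor`, nearest bond
triple's `V″ > 0` against crude far-shell sums; + GLOBAL zeroth-order certified grid on `(a,g,θ)` off the local tube; + the numerics-free
monotonicity `Φ(a,g,hollow) ≥ Φ(a,ĝ,hollow)` for `g ≥ ĝ`, `hc_layerSum_mono`); pairs at layer distance `k ≥ 2` change by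
`≥ −h(3k/4)·k·Σ‖θ_i − w_i‖²` (compression only helps: `hc_layerSum_mono`; offset change at the 3-fold symmetric points `{0, ±b} + Λ` costs at
most the sup-Hessian `h(H)` — certified for `H ∈ [3/2, 3]`, crude analytic (`hc_phiTaylor` order 1 + `hc_rot3`) beyond; floats `h(3/2) ≈ 1e-3`
against `κ ≥ 0.1`); bad interfaces (offset `η`-far from hollow, or gap `≥ ĝ + Δ`) recur syndetically (`hc_badOffsetSyndetic`,
`hc_wideGapSyndetic`); prisms `stub_layeredPrisms`, energies `gs_prismEnergy`, (U)/(L) at equal cardinality `nK²` leave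
`γ K² n' ≤ C K²` — contradiction. Numerics: floats in `Cruxes/PeriodicWindows` evidence (c10 `laminar_competitors_c10.md`, c11
`kappa_landscape.md`, c12 `bilayer_scan`). -/
theorem stub_hollowClosing : ∀ ρ₀ : ℝ, 0 < ρ₀ →
    ∀ x : (N : ℕ) → (Fin N → EuclideanSpace ℝ (Fin 3)), (∀ N, IsGroundState lennardJones (x N)) →
    ∀ Z : Set (EuclideanSpace ℝ (Fin 3)), (0 : EuclideanSpace ℝ (Fin 3)) ∈ Z →
    (∃ (σ : ℕ → ℕ) (τ : ℕ → EuclideanSpace ℝ (Fin 3))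
        (A : ℕ → (EuclideanSpace ℝ (Fin 3) ≃ₗᵢ[ℝ] EuclideanSpace ℝ (Fin 3))),
      StrictMono σ ∧ ∀ R ε : ℝ, 0 < ε → ∀ᶠ j in Filter.atTop,
        BallMatch ε R 0 (Set.range fun i => A j (x (σ j) i) + τ j) Z) →
    (∀ c : EuclideanSpace ℝ (Fin 3), ∃ p ∈ Z, dist p c ≤ ρ₀) →
    (∀ p ∈ Z, ∀ q ∈ Z, p 2 ≠ q 2 → (3 : ℝ) / 4 ≤ |p 2 - q 2|) →
    (∀ p ∈ Z, ∀ q ∈ Z, p ≠ q → (7 : ℝ) / 10 ≤ dist p q) →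
    (∀ R ε : ℝ, 0 < ε → ∃ G : ℝ, ∀ w ∈ Z, ∃ g ∈ Z, dist g w ≤ G ∧
      BallMatch ε R 0 ((fun p => p - g) '' Z) Z) →
    ∀ a : ℝ, 0 < a →
    ∀ (B : EuclideanSpace ℝ (Fin 3) ≃ₗᵢ[ℝ] EuclideanSpace ℝ (Fin 3)) (δ : ℤ → EuclideanSpace ℝ (Fin 3)) (z : ℤ → ℝ),
    (∀ p : EuclideanSpace ℝ (Fin 3), (B p) 2 = p 2) → (∀ m : ℤ, (δ m) 2 = 0) → δ 0 = 0 → z 0 = 0 → StrictMono z →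
    (∀ m : ℤ, (3 : ℝ) / 4 ≤ z (m + 1) - z m) → (∀ m : ℤ, z (m + 1) - z m ≤ 2 * ρ₀) →
    Z = (fun p => B p) '' {p | ∃ m i j : ℤ, p = ((i : ℝ) • triangularVec₁ a) +
      ((j : ℝ) • triangularVec₂ a) + δ m + (z m • layerNormal 1)} →
    (∀ m : ℤ, z (m + 1) - z m ≤ 1) →
    93 / 100 ≤ a → a ≤ 51 / 50 →
    (∀ m : ℤ, ∃ s i j : ℤ, (s = 1 ∨ s = -1) ∧ δ (m + 1) - δ m =
      (s : ℝ) • barlowOffset a + (i : ℝ) • triangularVec₁ a + (j : ℝ) • triangularVec₂ a) ∧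
    (∀ m : ℤ, z (m + 1) - z m ≤ Real.sqrt (1 - a ^ 2 / 3)) :=
  hc_hollowClosing_of_certs hc_cert_landscape hc_cert_farLayer

/-! ## TB `hc_templateOfHollow` — LANDED p172673 (c12 wave 1; imported: …HcTemplateOfHollow.lean) -/

/-- STUB PIN `stub_pinning` (c12; certified-numerics stub of the 11779 type — `LayeredHull.stub_convexity` / line `Sketch` E2 envelope
technology, now on an explicit Barlow-type family): a rooted, recurrent, dense, laminar, separated hull point which IS a Barlow-type template
of spacing `a ∈ [93/100, 51/50]` with free Hägg word and free gaps in `[3/4, ĝ(a)]` has `47/50 ≤ a ≤ 1` and all gaps in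
`[39a/50, 17a/20]` (the box of item 11779). Mechanism: absolute bulk optimality pins `a` (floats: `e(a) − e_* = +0.017 (0.94), 0 (0.971),
+0.0095 (1.00)` per particle) and the density closing with re-spaced competitors pins the gaps (ideal `0.8165 a`, box `±0.035 a`; zero normal
stress: first-order tail terms cancel at the optimal constant gap). -/
theorem stub_pinning : ∀ ρ₀ : ℝ, 0 < ρ₀ →
    ∀ x : (N : ℕ) → (Fin N → EuclideanSpace ℝ (Fin 3)), (∀ N, IsGroundState lennardJones (x N)) →
    ∀ Z : Set (EuclideanSpace ℝ (Fin 3)), (0 : EuclideanSpace ℝ (Fin 3)) ∈ Z →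
    (∃ (σ : ℕ → ℕ) (τ : ℕ → EuclideanSpace ℝ (Fin 3))
        (A : ℕ → (EuclideanSpace ℝ (Fin 3) ≃ₗᵢ[ℝ] EuclideanSpace ℝ (Fin 3))),
      StrictMono σ ∧ ∀ R ε : ℝ, 0 < ε → ∀ᶠ j in Filter.atTop,
        BallMatch ε R 0 (Set.range fun i => A j (x (σ j) i) + τ j) Z) →
    (∀ c : EuclideanSpace ℝ (Fin 3), ∃ p ∈ Z, dist p c ≤ ρ₀) →
    (∀ p ∈ Z, ∀ q ∈ Z, p 2 ≠ q 2 → (3 : ℝ) / 4 ≤ |p 2 - q 2|) →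
    (∀ p ∈ Z, ∀ q ∈ Z, p ≠ q → (7 : ℝ) / 10 ≤ dist p q) →
    (∀ R ε : ℝ, 0 < ε → ∃ G : ℝ, ∀ w ∈ Z, ∃ g ∈ Z, dist g w ≤ G ∧
      BallMatch ε R 0 ((fun p => p - g) '' Z) Z) →
    ∀ a : ℝ, 0 < a →
    93 / 100 ≤ a → a ≤ 51 / 50 →
    ∀ (B : EuclideanSpace ℝ (Fin 3) ≃ₗᵢ[ℝ] EuclideanSpace ℝ (Fin 3)) (s : ℤ → ℤ) (z : ℤ → ℝ),
    (∀ p : EuclideanSpace ℝ (Fin 3), (B p) 2 = p 2) → IsHaggSeq s → z 0 = 0 → StrictMono z →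
    (∀ m : ℤ, (3 : ℝ) / 4 ≤ z (m + 1) - z m) → (∀ m : ℤ, z (m + 1) - z m ≤ Real.sqrt (1 - a ^ 2 / 3)) →
    Z = (fun p => B p) '' {p | ∃ m i j : ℤ, p = ((i : ℝ) • triangularVec₁ a) +
      ((j : ℝ) • triangularVec₂ a) + ((haggLabel s m : ℝ) • barlowOffset a) + (z m • layerNormal 1)} →
    47 / 50 ≤ a ∧ a ≤ 1 ∧
      ∀ m : ℤ, 39 / 50 * a ≤ z (m + 1) - z m ∧ z (m + 1) - z m ≤ 17 / 20 * a := by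
  sorry

/-- P3b2′ (rev 7–8 stub, now PROVED from SW, HC, TB, PIN): as P3b2, under the EXTRA hypothesis (supplied by `stub_gapSqueeze`) that
every gap is `≤ 1`. Then `47/50 ≤ a ≤ 1` and `Z` is a rigid image of the layered TEMPLATE (hollow registry coded by a Hägg word, gaps in
`[39a/50, 17a/20]`). -/
theorem stub_closingOverTorusSqueezed : ∀ ρ₀ : ℝ, 0 < ρ₀ →
    ∀ x : (N : ℕ) → (Fin N → EuclideanSpace ℝ (Fin 3)), (∀ N, IsGroundState lennardJones (x N)) →
    ∀ Z : Set (EuclideanSpace ℝ (Fin 3)), (0 : EuclideanSpace ℝ (Fin 3)) ∈ Z →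
    (∃ (σ : ℕ → ℕ) (τ : ℕ → EuclideanSpace ℝ (Fin 3))
        (A : ℕ → (EuclideanSpace ℝ (Fin 3) ≃ₗᵢ[ℝ] EuclideanSpace ℝ (Fin 3))),
      StrictMono σ ∧ ∀ R ε : ℝ, 0 < ε → ∀ᶠ j in Filter.atTop,
        BallMatch ε R 0 (Set.range fun i => A j (x (σ j) i) + τ j) Z) →
    (∀ c : EuclideanSpace ℝ (Fin 3), ∃ p ∈ Z, dist p c ≤ ρ₀) →
    (∀ p ∈ Z, ∀ q ∈ Z, p 2 ≠ q 2 → (3 : ℝ) / 4 ≤ |p 2 - q 2|) →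
    (∀ p ∈ Z, ∀ q ∈ Z, p ≠ q → (7 : ℝ) / 10 ≤ dist p q) →
    (∀ R ε : ℝ, 0 < ε → ∃ G : ℝ, ∀ w ∈ Z, ∃ g ∈ Z, dist g w ≤ G ∧
      BallMatch ε R 0 ((fun p => p - g) '' Z) Z) →
    ∀ a : ℝ, 0 < a →
    ∀ (B : EuclideanSpace ℝ (Fin 3) ≃ₗᵢ[ℝ] EuclideanSpace ℝ (Fin 3)) (δ : ℤ → EuclideanSpace ℝ (Fin 3)) (z : ℤ → ℝ),
    (∀ p : EuclideanSpace ℝ (Fin 3), (B p) 2 = p 2) → (∀ m : ℤ, (δ m) 2 = 0) → δ 0 = 0 → z 0 = 0 → StrictMono z →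
    (∀ m : ℤ, (3 : ℝ) / 4 ≤ z (m + 1) - z m) → (∀ m : ℤ, z (m + 1) - z m ≤ 2 * ρ₀) →
    Z = (fun p => B p) '' {p | ∃ m i j : ℤ, p = ((i : ℝ) • triangularVec₁ a) +
      ((j : ℝ) • triangularVec₂ a) + δ m + (z m • layerNormal 1)} →
    (∀ m : ℤ, z (m + 1) - z m ≤ 1) →
    47 / 50 ≤ a ∧ a ≤ 1 ∧
      ∃ (B' : EuclideanSpace ℝ (Fin 3) ≃ₗᵢ[ℝ] EuclideanSpace ℝ (Fin 3)) (t₀ : EuclideanSpace ℝ (Fin 3))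
        (s : ℤ → ℤ) (z' : ℤ → ℝ), IsHaggSeq s ∧
        (∀ m : ℤ, 39 / 50 * a ≤ z' (m + 1) - z' m ∧ z' (m + 1) - z' m ≤ 17 / 20 * a) ∧
        Z = (fun p => B' p + t₀) '' {p | ∃ m i j : ℤ, p = ((i : ℝ) • triangularVec₁ a) +
          ((j : ℝ) • triangularVec₂ a) + ((haggLabel s m : ℝ) • barlowOffset a) + (z' m • layerNormal 1)} := by
  intro ρ₀ hρ₀ x hx Z h0 hhull hdense hlam hsep hrec a ha B δ z hB hδ hδ0 hz0 hz hgap hgap' hZ hsq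
  obtain ⟨ha₁, ha₂⟩ :=
    stub_scaleWindow ρ₀ hρ₀ x hx Z h0 hhull hdense hlam hsep hrec a ha B δ z hB hδ hδ0 hz0 hz hgap hgap' hZ hsq
  obtain ⟨hhol, hgh⟩ :=
    stub_hollowClosing ρ₀ hρ₀ x hx Z h0 hhull hdense hlam hsep hrec a ha B δ z hB hδ hδ0 hz0 hz hgap hgap' hZ hsq ha₁ ha₂
  obtain ⟨s, hs, hZ'⟩ := hc_templateOfHollow a ha B δ z hδ hδ0 hhol
  have hfun : (fun p : EuclideanSpace ℝ (Fin 3) => B p + (0 : EuclideanSpace ℝ (Fin 3))) = fun p => B p := by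
    funext p; rw [add_zero]
  have hZt : Z = (fun p => B p) '' {p | ∃ m i j : ℤ, p = ((i : ℝ) • triangularVec₁ a) +
      ((j : ℝ) • triangularVec₂ a) + ((haggLabel s m : ℝ) • barlowOffset a) + (z m • layerNormal 1)} := by
    rw [hZ, hZ', hfun]
  obtain ⟨ha₃, ha₄, hbox⟩ := stub_pinning ρ₀ hρ₀ x hx Z h0 hhull hdense hlam hsep hrec a ha ha₁ ha₂ B s z hB hs hz0 hz hgap
    hgh hZt
  refine ⟨ha₃, ha₄, B, 0, s, z, hs, hbox, ?_⟩
  rw [hfun]; exact hZt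

/-! ## P3b2 — closing over the offset torus, now PROVED from GS and P3b2′ -/

/-- P3b2 (rev 4–6 stub, now a theorem modulo `stub_gapSqueeze` / `stub_closingOverTorusSqueezed`): let `x` be a sequence of
Lennard-Jones ground states and `Z` a rooted, rooted-uniformly recurrent, `ρ₀`-dense, exactly laminar, `7/10`-separated point of
its rotated hull which is a horizontal-isometric image of the general layered set with data `(δ, z)` at spacing `a` (the output
of P3b1). Then `47/50 ≤ a ≤ 1` and `Z` is a rigid image of the layered template (hollow registry coded by a Hägg word, gaps in
`[39a/50, 17a/20]`): the gaps are first squeezed into `[3/4, 1]` (GS), then the torus closing applies (P3b2′). -/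
theorem stub_closingOverTorus : ∀ ρ₀ : ℝ, 0 < ρ₀ →
    ∀ x : (N : ℕ) → (Fin N → EuclideanSpace ℝ (Fin 3)), (∀ N, IsGroundState lennardJones (x N)) →
    ∀ Z : Set (EuclideanSpace ℝ (Fin 3)), (0 : EuclideanSpace ℝ (Fin 3)) ∈ Z →
    (∃ (σ : ℕ → ℕ) (τ : ℕ → EuclideanSpace ℝ (Fin 3))
        (A : ℕ → (EuclideanSpace ℝ (Fin 3) ≃ₗᵢ[ℝ] EuclideanSpace ℝ (Fin 3))),
      StrictMono σ ∧ ∀ R ε : ℝ, 0 < ε → ∀ᶠ j in Filter.atTop,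
        BallMatch ε R 0 (Set.range fun i => A j (x (σ j) i) + τ j) Z) →
    (∀ c : EuclideanSpace ℝ (Fin 3), ∃ p ∈ Z, dist p c ≤ ρ₀) →
    (∀ p ∈ Z, ∀ q ∈ Z, p 2 ≠ q 2 → (3 : ℝ) / 4 ≤ |p 2 - q 2|) →
    (∀ p ∈ Z, ∀ q ∈ Z, p ≠ q → (7 : ℝ) / 10 ≤ dist p q) →
    (∀ R ε : ℝ, 0 < ε → ∃ G : ℝ, ∀ w ∈ Z, ∃ g ∈ Z, dist g w ≤ G ∧
      BallMatch ε R 0 ((fun p => p - g) '' Z) Z) →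
    ∀ a : ℝ, 0 < a →
    ∀ (B : EuclideanSpace ℝ (Fin 3) ≃ₗᵢ[ℝ] EuclideanSpace ℝ (Fin 3)) (δ : ℤ → EuclideanSpace ℝ (Fin 3)) (z : ℤ → ℝ),
    (∀ p : EuclideanSpace ℝ (Fin 3), (B p) 2 = p 2) → (∀ m : ℤ, (δ m) 2 = 0) → δ 0 = 0 → z 0 = 0 → StrictMono z →
    (∀ m : ℤ, (3 : ℝ) / 4 ≤ z (m + 1) - z m) → (∀ m : ℤ, z (m + 1) - z m ≤ 2 * ρ₀) →
    Z = (fun p => B p) '' {p | ∃ m i j : ℤ, p = ((i : ℝ) • triangularVec₁ a) +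
      ((j : ℝ) • triangularVec₂ a) + δ m + (z m • layerNormal 1)} →
    47 / 50 ≤ a ∧ a ≤ 1 ∧
      ∃ (B' : EuclideanSpace ℝ (Fin 3) ≃ₗᵢ[ℝ] EuclideanSpace ℝ (Fin 3)) (t₀ : EuclideanSpace ℝ (Fin 3))
        (s : ℤ → ℤ) (z' : ℤ → ℝ), IsHaggSeq s ∧
        (∀ m : ℤ, 39 / 50 * a ≤ z' (m + 1) - z' m ∧ z' (m + 1) - z' m ≤ 17 / 20 * a) ∧
        Z = (fun p => B' p + t₀) '' {p | ∃ m i j : ℤ, p = ((i : ℝ) • triangularVec₁ a) +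
          ((j : ℝ) • triangularVec₂ a) + ((haggLabel s m : ℝ) • barlowOffset a) + (z' m • layerNormal 1)} := by
  intro ρ₀ hρ₀ x hx Z h0 hhull hdense hlam hsep hrec a ha B δ z hB hδ hδ0 hz0 hz hgap hgap' hZ
  exact stub_closingOverTorusSqueezed ρ₀ hρ₀ x hx Z h0 hhull hdense hlam hsep hrec a ha B δ z hB hδ hδ0 hz0 hz hgap hgap' hZ
    (stub_gapSqueeze ρ₀ hρ₀ x hx Z h0 hhull hdense hlam hsep hrec a ha B δ z hB hδ hδ0 hz0 hz hgap hgap' hZ)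

/-! ## P3b — registry and pinning: aligned triangular layers ⇒ the layered template, now PROVED from P3b1 and P3b2 -/


/-- P3b (rev 3 stub, now a theorem modulo P3b1/P3b2): if moreover all layers of `Z` are
translates of one horizontal triangular lattice of spacing `a` (the conclusion of P3a), then `47/50 ≤ a ≤ 1` and `Z` is a
rigid image `B '' S(a, s, z) + t₀` of the layered template — consecutive layers in HOLLOW registry (lateral offsets
`haggLabel s m • barlowOffset a` for a Hägg word `s`) with gaps `z (m+1) - z m ∈ [39a/50, 17a/20]`. Expected mechanism: index
the layers by `ℤ` in height order (laminarity + density); a non-hollow lateral offset, an out-of-box gap or an out-of-box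
spacing recurs with bounded gaps (uniform recurrence), so on prisms `n × K × K` its certified per-site price is linear in the
volume, while the window bounds (U)/(L) at EQUAL cardinality against the explicit re-registered / re-spaced prism differ by
`O(nK + K²)` — the density closing of `LayeredHull.stub_closing` (item 11779) run over the lateral-offset torus and the gap /
scale variables instead of the Hägg alphabet (new certified numerics: the bilayer registry landscape at gaps `≥ 3/4`, where
hollow wins only because repulsion is active — at large gaps the `r⁻⁶` tail alone would favour eclipsed registry —, zero
normal stress and the scale box). Large but of a type the tree has done once. -/
theorem stub_templateOfAlignedTriangularLayers : ∀ ρ₀ : ℝ, 0 < ρ₀ →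
    ∀ x : (N : ℕ) → (Fin N → EuclideanSpace ℝ (Fin 3)), (∀ N, IsGroundState lennardJones (x N)) →
    ∀ Z : Set (EuclideanSpace ℝ (Fin 3)), (0 : EuclideanSpace ℝ (Fin 3)) ∈ Z →
    (∃ (σ : ℕ → ℕ) (τ : ℕ → EuclideanSpace ℝ (Fin 3))
        (A : ℕ → (EuclideanSpace ℝ (Fin 3) ≃ₗᵢ[ℝ] EuclideanSpace ℝ (Fin 3))),
      StrictMono σ ∧ ∀ R ε : ℝ, 0 < ε → ∀ᶠ j in Filter.atTop,
        BallMatch ε R 0 (Set.range fun i => A j (x (σ j) i) + τ j) Z) →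
    (∀ c : EuclideanSpace ℝ (Fin 3), ∃ p ∈ Z, dist p c ≤ ρ₀) →
    (∀ p ∈ Z, ∀ q ∈ Z, p 2 ≠ q 2 → (3 : ℝ) / 4 ≤ |p 2 - q 2|) →
    (∀ p ∈ Z, ∀ q ∈ Z, p ≠ q → (7 : ℝ) / 10 ≤ dist p q) →
    (∀ R ε : ℝ, 0 < ε → ∃ G : ℝ, ∀ w ∈ Z, ∃ g ∈ Z, dist g w ≤ G ∧
      BallMatch ε R 0 ((fun p => p - g) '' Z) Z) →
    ∀ a : ℝ, 0 < a → ∀ u v : EuclideanSpace ℝ (Fin 3), u 2 = 0 → v 2 = 0 → ‖u‖ = a → ‖v‖ = a →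
    inner ℝ u v = a ^ 2 / 2 →
    (∀ p ∈ Z, {q | q ∈ Z ∧ q 2 = p 2} = {q | ∃ i j : ℤ, q = p + (i : ℝ) • u + (j : ℝ) • v}) →
    47 / 50 ≤ a ∧ a ≤ 1 ∧
      ∃ (B : EuclideanSpace ℝ (Fin 3) ≃ₗᵢ[ℝ] EuclideanSpace ℝ (Fin 3)) (t₀ : EuclideanSpace ℝ (Fin 3))
        (s : ℤ → ℤ) (z : ℤ → ℝ), IsHaggSeq s ∧
        (∀ m : ℤ, 39 / 50 * a ≤ z (m + 1) - z m ∧ z (m + 1) - z m ≤ 17 / 20 * a) ∧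
        Z = (fun p => B p + t₀) '' {p | ∃ m i j : ℤ, p = ((i : ℝ) • triangularVec₁ a) +
          ((j : ℝ) • triangularVec₂ a) + ((haggLabel s m : ℝ) • barlowOffset a) + (z m • layerNormal 1)} := by
  intro ρ₀ hρ₀ x hx Z h0 hhull hdense hlam hsep hrec a ha u v hu hv hua hva huv hlayers
  obtain ⟨B, δ, z, hB, hδ, hδ0, hz0, hz, hgap, hgap', hZ⟩ :=
    stub_layerData ρ₀ hρ₀ Z h0 hdense hlam a ha u v hu hv hua hva huv hlayers
  exact stub_closingOverTorus ρ₀ hρ₀ x hx Z h0 hhull hdense hlam hsep hrec a ha B δ z hB hδ hδ0 hz0 hz hgap hgap' hZ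

/-! ## P3 — rigidity of a recurrent dense laminar separated rotated-hull point, now PROVED from P3a and P3b -/

/-- P3 (rev 1 stub, now a theorem modulo P3a/P3b): let `x` be a sequence of Lennard-Jones ground states and `Z` a
rooted, rooted-uniformly recurrent, `ρ₀`-dense, exactly laminar, `7/10`-separated point of its rotated hull. Then `Z` is a
rigid image `B '' S(a, s, z) + t₀` of a layered template: triangular layers of ONE spacing `a ∈ [47/50, 1]` in hollow
registry (`haggLabel s m • barlowOffset a`, `s` a Hägg word) at heights `z m` with gaps in `[39a/50, 17a/20]`
(P3a: aligned triangular layers — the open core; P3b: registry and pinning). -/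
theorem stub_rigidityOfRecurrentLaminarHullPoint : ∀ ρ₀ : ℝ, 0 < ρ₀ →
    ∀ x : (N : ℕ) → (Fin N → EuclideanSpace ℝ (Fin 3)), (∀ N, IsGroundState lennardJones (x N)) →
    ∀ Z : Set (EuclideanSpace ℝ (Fin 3)), (0 : EuclideanSpace ℝ (Fin 3)) ∈ Z →
    (∃ (σ : ℕ → ℕ) (τ : ℕ → EuclideanSpace ℝ (Fin 3))
        (A : ℕ → (EuclideanSpace ℝ (Fin 3) ≃ₗᵢ[ℝ] EuclideanSpace ℝ (Fin 3))),
      StrictMono σ ∧ ∀ R ε : ℝ, 0 < ε → ∀ᶠ j in Filter.atTop,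
        BallMatch ε R 0 (Set.range fun i => A j (x (σ j) i) + τ j) Z) →
    (∀ c : EuclideanSpace ℝ (Fin 3), ∃ p ∈ Z, dist p c ≤ ρ₀) →
    (∀ p ∈ Z, ∀ q ∈ Z, p 2 ≠ q 2 → (3 : ℝ) / 4 ≤ |p 2 - q 2|) →
    (∀ p ∈ Z, ∀ q ∈ Z, p ≠ q → (7 : ℝ) / 10 ≤ dist p q) →
    (∀ R ε : ℝ, 0 < ε → ∃ G : ℝ, ∀ w ∈ Z, ∃ g ∈ Z, dist g w ≤ G ∧
      BallMatch ε R 0 ((fun p => p - g) '' Z) Z) →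
    ∃ a : ℝ, 47 / 50 ≤ a ∧ a ≤ 1 ∧
      ∃ (B : EuclideanSpace ℝ (Fin 3) ≃ₗᵢ[ℝ] EuclideanSpace ℝ (Fin 3)) (t₀ : EuclideanSpace ℝ (Fin 3))
        (s : ℤ → ℤ) (z : ℤ → ℝ), IsHaggSeq s ∧
        (∀ m : ℤ, 39 / 50 * a ≤ z (m + 1) - z m ∧ z (m + 1) - z m ≤ 17 / 20 * a) ∧
        Z = (fun p => B p + t₀) '' {p | ∃ m i j : ℤ, p = ((i : ℝ) • triangularVec₁ a) +
          ((j : ℝ) • triangularVec₂ a) + ((haggLabel s m : ℝ) • barlowOffset a) + (z m • layerNormal 1)} := by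
  intro ρ₀ hρ₀ x hx Z h0 hhull hdense hlam hsep hrec
  obtain ⟨a, ha, u, v, hu, hv, hua, hva, huv, hlayers⟩ :=
    stub_alignedTriangularLayers ρ₀ hρ₀ x hx Z h0 hhull hdense hlam hsep hrec
  obtain ⟨ha₁, ha₂, htempl⟩ :=
    stub_templateOfAlignedTriangularLayers ρ₀ hρ₀ x hx Z h0 hhull hdense hlam hsep hrec a ha u v hu hv hua hva huv hlayers
  exact ⟨a, ha₁, ha₂, htempl⟩


/-! ## Stub P2 `stub_windowsOfTemplateHullPoint` — LANDED p142408 (imported: …StubWindowsOfTemplateHullPoint.lean) -/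

/-! ## Old stub 3, now PROVED from P1, P3, P2 -/

/-- The strategist's stub 3 (verbatim signature), now a theorem modulo P1/P3/P2: a dense, exactly laminar, separated
rotated-hull point of a ground-state sequence forces the layered windows of item 11778 along the sequence. -/
theorem stub_layeredOfDenseLaminarHullPoint : ∀ ρ₀ : ℝ, 0 < ρ₀ →
    ∀ x : (N : ℕ) → (Fin N → EuclideanSpace ℝ (Fin 3)), (∀ N, IsGroundState lennardJones (x N)) →
    (∃ X : Set (EuclideanSpace ℝ (Fin 3)),
      (∃ (σ : ℕ → ℕ) (τ : ℕ → EuclideanSpace ℝ (Fin 3))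
          (A : ℕ → (EuclideanSpace ℝ (Fin 3) ≃ₗᵢ[ℝ] EuclideanSpace ℝ (Fin 3))),
        StrictMono σ ∧ ∀ R ε : ℝ, 0 < ε → ∀ᶠ j in Filter.atTop,
          BallMatch ε R 0 (Set.range fun i => A j (x (σ j) i) + τ j) X) ∧
      (∀ c : EuclideanSpace ℝ (Fin 3), ∃ p ∈ X, dist p c ≤ ρ₀) ∧
      (∀ p ∈ X, ∀ q ∈ X, p 2 ≠ q 2 → (3 : ℝ) / 4 ≤ |p 2 - q 2|) ∧
      (∀ p ∈ X, ∀ q ∈ X, p ≠ q → (7 : ℝ) / 10 ≤ dist p q)) →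
    ∃ a : ℝ, 47 / 50 ≤ a ∧ a ≤ 1 ∧ ∀ R ε : ℝ, 0 < ε → ∃ᶠ N in Filter.atTop,
      ∃ (A : EuclideanSpace ℝ (Fin 3) →ₗᵢ[ℝ] EuclideanSpace ℝ (Fin 3)) (t : EuclideanSpace ℝ (Fin 3)) (s : ℤ → ℤ)
        (z : ℤ → ℝ), IsHaggSeq s ∧ (∀ m : ℤ, 39 / 50 * a ≤ z (m + 1) - z m ∧ z (m + 1) - z m ≤ 17 / 20 * a) ∧
        let S : Set (EuclideanSpace ℝ (Fin 3)) := {p | ∃ m i j : ℤ, p = A (((i : ℝ) • triangularVec₁ a) +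
          ((j : ℝ) • triangularVec₂ a) + ((haggLabel s m : ℝ) • barlowOffset a) + (z m • layerNormal 1))};
        (∀ p ∈ S, ‖p‖ ≤ R → ∃ i : Fin N, dist (x N i + t) p ≤ ε) ∧
        (∀ i : Fin N, ‖x N i + t‖ ≤ R → ∃ p ∈ S, dist (x N i + t) p ≤ ε) := by
  intro ρ₀ hρ₀ x hx hX
  obtain ⟨Z, h0, hhull, hdense, hlam, hsep, hrec⟩ := stub_recurrentHullPoint ρ₀ hρ₀ x hX
  obtain ⟨a, ha, ha', htempl⟩ :=
    stub_rigidityOfRecurrentLaminarHullPoint ρ₀ hρ₀ x hx Z h0 hhull hdense hlam hsep hrec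
  exact ⟨a, ha, ha', stub_windowsOfTemplateHullPoint x a Z hhull htempl⟩

/-! ## COMPOSITION -/

/-- COMPOSITION (checked, no `sorry` of its own): the input stub (≡ item 18044), P1, P3, P2 give the crux `PeriodicWindows` BY
NAME — a dense exactly laminar separated rotated-hull point ⇒ layered windows (`stub_layeredOfDenseLaminarHullPoint` = P1 → P3 →
P2) ⇒ the crux's clause (landed `PeriodicGivenLayered_of`, item 11779). (The rev 1–6 input route 14293 ∧ 13453 ⇒ 18044 is the
landed `PeriodicWindowsSplit3.denseLaminarHullPoint_of_board`.) -/
theorem PeriodicWindows_of : PeriodicWindows := by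
  intro x hx
  obtain ⟨ρ₀, hρ₀, hX⟩ := stub_denseLaminarHullPoint
  have hlay := stub_layeredOfDenseLaminarHullPoint ρ₀ hρ₀ x hx (hX x hx)
  have hpgl := Summit.AtomisticToContinuum.Crystallization.Theorems.LayeredHull.PeriodicGivenLayered_of
  unfold Summit.AtomisticToContinuum.Crystallization.Theses.PhononSlackCertificates.PeriodicGivenLayered at hpgl
  exact hpgl x hx hlay

/-- The same composition read as the crux decl of route `HullMinimality` (shared item stmt-3240; the two route decls
`ChessboardParticlePlanes.PeriodicWindows` and `HullMinimality.PeriodicWindows` have byte-identical bodies). -/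
theorem PeriodicWindows_of_hullMinimality :
    Summit.AtomisticToContinuum.Crystallization.Theses.HullMinimality.PeriodicWindows :=
  PeriodicWindows_of

end Summit.AtomisticToContinuum.Crystallization.Theorems.PeriodicWindowsDenseLaminarHull

end
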